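import Summits.AnomalousDissipation.AnomalousDissipation.Theorems.SolenoidalFractalHomogenisationLagrangianStepD1TailBoundDiag
import Summits.AnomalousDissipation.AnomalousDissipation.Theorems.SolenoidalFractalHomogenisationLagrangianStepD1SlotPairData
import Summits.AnomalousDissipation.AnomalousDissipation.Theorems.SolenoidalFractalHomogenisationLagrangianStepD1TailCrushCert
import HarnessLib

/-!
# K1L_D `stub_D1_V0thg` (stmt-AnomalousDissipation-27980), R3′ lane, R3′-2 `D1TailCrushBound` spine: THE ε-SCALED END GAME and THE CRUSHED
# TABLE SOCKET on lane A's table `gTail` (helper; `--supports stmt-AnomalousDissipation-27980 --as helper`)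

Helper file of route `SolenoidalFractalHomogenisation` (one-generation hand `leafhand-ad-solenoidalfractalh-1` g1, road E-c).  Lane A4's common end game
`D1Tail.tail_bound_of_decomp` (case files `…D1TailBound{Diag,Far,Adj,Pair}`) hard-codes the ν-free in-slot decay `e^{−θmin}` in the pointwise bound of the
slot integrand and returns the table `gTail`.  In the crushed lane (R3′-2) the state entering the pickup (or source) slot is bounded instead by a
ν-DEPENDENT factor `ε(ν)` (the crushed periodic response, `Sideband.norm_responseExt_le_crushed_nu`), and every case proof goes through verbatim with
`ε` in place of `e^{−θmin}`.  This file supplies the two ε-generic sockets: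
* `tail_arith_eps`, **`tail_bound_of_decomp_eps`** — the end game with an arbitrary factor `ε`: conclusion `|tailKernel ν S p q j j'| ≤
  (ε·e^{θmin})·gTail j j'·(√PpSq_j(p)·√PpSq_{j'}(q))`;
* **`residueTail_of_crushedSlotPairBounds_gTail`** — the ν-scaled composition socket ON LANE A's TABLE `gTail` (Frobenius weight `frob_gTail_le`, the
  structure identity `bsymb_tail_eq_slotPair` of lane A1 already plugged): per-pair bounds `|tailKernel ν S p q j j'| ≤ E ν·gTail j j'·(…)` ⇒
  `RelSmall (psiStar − excQS − pairQS) excQS (E ν/200000)` on the sectorial block window.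
What is NOT here: the crushed per-pair bounds themselves (the ε-twins of cases A–E fed by `norm_responseExt_le_crushed_nu` and the static-slot census).
No definitions, no sorry.  NOT a proof of `stub_D1_V0thg`, of K1L_D or of AD; rung F-D1.A0 infrastructure.
-/

set_option linter.dupNamespace false

noncomputable section

namespace Summit.AnomalousDissipation.AnomalousDissipation.Theorems.SolenoidalFractalHomogenisation.LagrangianStep.D1Tail

open Summit.AnomalousDissipation.AnomalousDissipation.Theorems
open Summit.AnomalousDissipation.AnomalousDissipation.Theorems.SolenoidalFractalHomogenisation.LagrangianStep
open Summit.AnomalousDissipation.AnomalousDissipation.Theorems.SolenoidalFractalHomogenisation.LagrangianStep.WCrossing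
open Summit.AnomalousDissipation.AnomalousDissipation.Theorems.SolenoidalFractalHomogenisation.LagrangianStep.D1ResidueCert
open Summit.AnomalousDissipation.AnomalousDissipation.Theorems.SolenoidalFractalHomogenisation.LagrangianStep.D1TailCert
open Summit.AnomalousDissipation.AnomalousDissipation.Theorems.SolenoidalFractalHomogenisation.LagrangianStep.Sideband
open Summit.AnomalousDissipation.AnomalousDissipation.Theorems.SolenoidalFractalHomogenisation.PermissibleCarrier (period_pos)
open Literature.Analysis Literature.Analysis.FluidPDE Literature.Analysis.FunctionSpaces Literature.Analysis.FunctionSpaces.Torus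
open Literature.Analysis.FluidPDE.Torus Literature.Analysis.FluidPDE.LatticeShear
open Set Real Complex MeasureTheory intervalIntegral
open scoped InnerProductSpace

/-! ## §1 The ε-scaled arithmetic and end game -/

/-- `ε = (ε·e^{θmin})·e^{−θmin}`. [folklore] -/
theorem eps_eq_mul_exp (ε : ℝ) : ε = ε * Real.exp θmin * Real.exp (-θmin) := by
  rw [mul_assoc, ← Real.exp_add, add_neg_cancel, Real.exp_zero, mul_one]

/-- **THE ν's CANCEL, ε-scaled**: `tail_arith` with an arbitrary factor `ε` in place of `e^{−θmin}`; the value is `(ε·e^{θmin})·gTail j j'·(A·B)`.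
[cite: ArmstrongVicol2025, §3] -/
theorem tail_arith_eps {ν : ℝ} (hν : 0 < ν) (hν40 : ν ≤ 1 / 40) (j j' : Fin 26) (A B ε : ℝ) :
    let W₁ := (cubatureWord.stretch MB MB_pos).stretch (1 / ν) (one_div_pos.mpr hν)
    ν / (4 * π ^ 2) * ((1 / W₁.period) * ((1 / (2 * ‖latticeVec (cubatureWord.phase j).m‖) * A *
        (2 * (ε * (8 * π * ‖slotAmp W₁ j'‖ / min (1:ℝ) (4 * π ^ 2 * (ν * (10 / 11))) * B)))) * (W₁.phase j).τ)) =
      ε * Real.exp θmin * gTail j j' * (A * B) := by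
  intro W₁
  have h := tail_arith hν hν40 j j' A B
  simp only at h
  rw [mul_assoc (ε * Real.exp θmin), ← h]
  conv_lhs => rw [eps_eq_mul_exp ε]
  ring

/-- **THE ε-SCALED END GAME.**  `tail_bound_of_decomp` with an arbitrary factor `ε` in the pointwise bound of the slot integrand:
if `(ν/4π²)·Re⟪pC, M_{jj'} qC⟫ − Re⟪pC, cmat(freshMat S j j') qC⟫ = (ν/4π²)·Re⟪pC, (1/P₁) • ∫_{slot j} X⟫` and on the slot
`‖⟪pC, X t⟫‖ ≤ (1/(2|mⱼ|))·‖Pⱼ pC‖·(2·(ε·((8π‖α_{j'}‖/r)·‖P_{j'} qC‖)))`, then `|tailKernel ν S p q j j'| ≤ (ε·e^{θmin})·gTail j j'·(√PpSq_j(p)·√PpSq_{j'}(q))`.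
[cite: ArmstrongVicol2025, §3 (renormalised diffusivity of one level)] -/
theorem tail_bound_of_decomp_eps {ν : ℝ} (hν : ν ∈ Ioc (0:ℝ) (1 / 40)) (S : T4) (p q : Fin 3 → ℝ) (j j' : Fin 26) (ε : ℝ)
    (X : ℝ → EuclideanSpace ℂ (Fin 3))
    (hXint : IntervalIntegrable X volume (((cubatureWord.stretch MB MB_pos).stretch (1 / ν) (one_div_pos.mpr hν.1)).start j)
      (((cubatureWord.stretch MB MB_pos).stretch (1 / ν) (one_div_pos.mpr hν.1)).start j +
        (((cubatureWord.stretch MB MB_pos).stretch (1 / ν) (one_div_pos.mpr hν.1)).phase j).τ))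
    (hM : ν / (4 * π ^ 2) * (⟪(WithLp.toLp 2 fun i => ((p i : ℝ) : ℂ) : EuclideanSpace ℂ (Fin 3)),
        meanFeedback ((cubatureWord.stretch MB MB_pos).stretch (1 / ν) (one_div_pos.mpr hν.1)) (ν • S) 1 (R0 ν) j j'
          (WithLp.toLp 2 fun i => ((q i : ℝ) : ℂ))⟫_ℂ).re -
      (⟪(WithLp.toLp 2 fun i => ((p i : ℝ) : ℂ) : EuclideanSpace ℂ (Fin 3)),
        Matrix.toEuclideanCLM (n := Fin 3) (𝕜 := ℂ) ((freshMat S j j').map ((↑) : ℝ → ℂ)) (WithLp.toLp 2 fun i => ((q i : ℝ) : ℂ))⟫_ℂ).re =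
      ν / (4 * π ^ 2) * (⟪(WithLp.toLp 2 fun i => ((p i : ℝ) : ℂ) : EuclideanSpace ℂ (Fin 3)),
        (1 / ((cubatureWord.stretch MB MB_pos).stretch (1 / ν) (one_div_pos.mpr hν.1)).period) •
          ∫ t in ((cubatureWord.stretch MB MB_pos).stretch (1 / ν) (one_div_pos.mpr hν.1)).start j..((cubatureWord.stretch MB MB_pos).stretch
            (1 / ν) (one_div_pos.mpr hν.1)).start j + (((cubatureWord.stretch MB MB_pos).stretch (1 / ν) (one_div_pos.mpr hν.1)).phase j).τ, X t⟫_ℂ).re)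
    (hpt : ∀ t ∈ Set.uIoc (((cubatureWord.stretch MB MB_pos).stretch (1 / ν) (one_div_pos.mpr hν.1)).start j)
      (((cubatureWord.stretch MB MB_pos).stretch (1 / ν) (one_div_pos.mpr hν.1)).start j +
        (((cubatureWord.stretch MB MB_pos).stretch (1 / ν) (one_div_pos.mpr hν.1)).phase j).τ),
      ‖⟪(WithLp.toLp 2 fun i => ((p i : ℝ) : ℂ) : EuclideanSpace ℂ (Fin 3)), X t⟫_ℂ‖ ≤
        1 / (2 * ‖latticeVec (cubatureWord.phase j).m‖) * ‖transversalProj (cubatureWord.phase j).m (WithLp.toLp 2 fun i => ((p i : ℝ) : ℂ) : EuclideanSpace ℂ (Fin 3))‖ *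
          (2 * (ε * (8 * π * ‖slotAmp ((cubatureWord.stretch MB MB_pos).stretch (1 / ν) (one_div_pos.mpr hν.1)) j'‖ /
            min (1:ℝ) (4 * π ^ 2 * (ν * (10 / 11))) * ‖transversalProj (cubatureWord.phase j').m (WithLp.toLp 2 fun i => ((q i : ℝ) : ℂ) : EuclideanSpace ℂ (Fin 3))‖)))) :
    |tailKernel ν S p q j j'| ≤ ε * Real.exp θmin * gTail j j' * (Real.sqrt (PpSq j p) * Real.sqrt (PpSq j' q)) := by
  obtain ⟨hν0, hν40⟩ := hν
  set W₁ := (cubatureWord.stretch MB MB_pos).stretch (1 / ν) (one_div_pos.mpr hν0) with hW₁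
  set pC : EuclideanSpace ℂ (Fin 3) := WithLp.toLp 2 fun i => ((p i : ℝ) : ℂ) with hpC
  set qC : EuclideanSpace ℂ (Fin 3) := WithLp.toLp 2 fun i => ((q i : ℝ) : ℂ) with hqC
  set s := W₁.start j with hs
  set L := (W₁.phase j).τ with hL
  have hLpos : 0 < L := (W₁.phase j).τ_pos
  -- `ε ≥ 0` is forced by `hpt` at any point of the (nonempty) slot unless the pickup prefactor vanishes; we avoid the case split by bounding `|…|`
  set C : ℝ := 1 / (2 * ‖latticeVec (cubatureWord.phase j).m‖) * ‖transversalProj (cubatureWord.phase j).m pC‖ *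
    (2 * (ε * (8 * π * ‖slotAmp W₁ j'‖ / min (1:ℝ) (4 * π ^ 2 * (ν * (10 / 11))) * ‖transversalProj (cubatureWord.phase j').m qC‖)))
    with hC
  have hinner : ‖⟪pC, ∫ t in s..s + L, X t⟫_ℂ‖ ≤ C * |s + L - s| := norm_inner_integral_le_of_le hXint pC hpt
  rw [show s + L - s = L by ring, abs_of_pos hLpos] at hinner
  rw [tailKernel_eq_re_inner hν0, hM, ← Complex.coe_smul, inner_smul_right, Complex.re_ofReal_mul]
  have hP0 : 0 < W₁.period := period_pos W₁
  have hν' : 0 ≤ ν / (4 * π ^ 2) := by positivity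
  calc |ν / (4 * π ^ 2) * (1 / W₁.period * (⟪pC, ∫ t in s..s + L, X t⟫_ℂ).re)|
      = ν / (4 * π ^ 2) * (1 / W₁.period * |(⟪pC, ∫ t in s..s + L, X t⟫_ℂ).re|) := by
        rw [abs_mul, abs_mul, abs_of_nonneg hν', abs_of_pos (by positivity : (0:ℝ) < 1 / W₁.period)]
    _ ≤ ν / (4 * π ^ 2) * (1 / W₁.period * (C * L)) :=
        mul_le_mul_of_nonneg_left (mul_le_mul_of_nonneg_left ((Complex.abs_re_le_norm _).trans hinner) (by positivity)) hν'
    _ = ε * Real.exp θmin * gTail j j' * (Real.sqrt (PpSq j p) * Real.sqrt (PpSq j' q)) := by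
        rw [hC, ← norm_transversalProj_realVec j p, ← norm_transversalProj_realVec j' q, ← hpC, ← hqC]
        have h := tail_arith_eps hν0 hν40 j j' ‖transversalProj (cubatureWord.phase j).m pC‖ ‖transversalProj (cubatureWord.phase j').m qC‖ ε
        simp only at h
        rw [← hW₁] at h
        rw [← h, hL]

/-! ## §2 The crushed table socket on lane A's table `gTail` -/

/-- **R3′-2 OUTPUT SHAPE ON LANE A's TABLE.**  If for every `ν ∈ (0, νB₁]` and every block-window background the 676 per-pair bounds hold with lane A's
table `gTail` scaled by a factor `E ν` — `|tailKernel ν S p q j j'| ≤ E ν·gTail j j'·(√PpSq_j(p)·√PpSq_{j'}(q))` — then the tail is `RelSmall` of size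
`E ν/200000` relative to `excQS` (`relSmall_tail_of_scaledTable` with `frob_gTail_le` and the structure identity `bsymb_tail_eq_slotPair`).
[cite: ArmstrongVicol2025, §3 (renormalised diffusivity of one level)] [cite: MajdaKramer1999, §2.2.1.3 (55)] -/
theorem residueTail_of_crushedSlotPairBounds_gTail (E : ℝ → ℝ)
    (hbound : ∀ ν ∈ Set.Ioc 0 νB₁, ∀ S : Torus.Visc4 (Fin 3), Torus.NearIso S (10 / 11) (11 / 10) →
      ∀ τ ∈ Set.Icc (0:ℝ) (1 / 20), OddSectorial S τ →
        ∀ p q : Fin 3 → ℝ, ∀ j j', |tailKernel ν S p q j j'| ≤ E ν * gTail j j' * (Real.sqrt (PpSq j p) * Real.sqrt (PpSq j' q))) :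
    ∀ ν ∈ Set.Ioc 0 νB₁, ∀ S : Torus.Visc4 (Fin 3), Torus.NearIso S (10 / 11) (11 / 10) →
      ∀ τ ∈ Set.Icc (0:ℝ) (1 / 20), OddSectorial S τ →
        RelSmall (Sideband.psiStar cubatureWord MB MB_pos ν S - excQS cubatureWord MB S - pairQS S)
          (excQS cubatureWord MB S) (E ν / 200000) :=
  fun ν hν S hS τ hτ hodd =>
    relSmall_tail_of_scaledTable frob_gTail_le (E ν) hS hτ hodd (tailKernel ν S) (fun k p q _ _ => bsymb_tail_eq_slotPair hν.1 S k p q)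
      (hbound ν hν S hS τ hτ hodd)

end Summit.AnomalousDissipation.AnomalousDissipation.Theorems.SolenoidalFractalHomogenisation.LagrangianStep.D1Tail

end
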